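import Mathlib
import Summits.CriticalPhenomena.SAWScalingLimit.Theorems.SAWDefectDecoherenceDefectDecoherenceSsTipRegrouping
import Literature.Probability.RandomPlanarGeometry.HexParafermionModes
import HarnessLib

/-!
# Dressing pairs, auxiliary file: DCS's pair involution in every character, transported;
no dressing in the unstable sector (helpers `ss_unstableNoDressing`, `ss_dirtySum_eq` for the stub
`stub_dressedDefectDecay` of the line `sector-slaving`, crux `DefectDecoherence`,
stmt-CriticalPhenomena-8549)

The loop-dressed ("dirty") arrivals at a vertex `v` — walks from the root `a = s(u,w)` ending on a
mid-edge `mid{s,v}` with last vertex the neighbour `s`, having visited `v` earlier — form DCS's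
class "three mid-edges" (a self-avoiding path to `v` plus a loop from `v` to `v`).  The pair
involution `loopRev` (traverse the loop the other way; `HexSAWObservable.lean`,
`HexParafermionLoop.lean`) preserves vertex set and length and changes the winding by `8·(π/3)·τ`,
`τ = ±1` the turn at `v` INTO the loop (`HV.pturn_lw_rev_of_wnd`; uses: root on the boundary, `Λ`
simply connected).  Contents:

* `ss_hv_pairs`: in the coordinate model `HV`, for EVERY character `ξ`,
  `Σ_{loop walks at x} x_c^{ℓ+1} e^{-iξ(θ_a + (π/3)·pturn)} = (1 + e^{-iξ·8π/3}) · Σ_{LEFT-FIRST ones}`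
  (`loopRev` maps left-first, `turn = +1`, onto right-first; `ss_hv_loop_spec`,
  `ss_hv_leftFirst_lw_iff`);
* `ss_winding_eq_pturn_code`: the geometric winding of a walk between mid-edges is `(π/3)·pturn`
  of its code `wOut :: Φ(γ) ++ [Φ e]` (the step isolated from `HexMidEdgeSAW.weight_eq_pwt`);
* `ss_dirty_transport`: for classes `p` (vertex lists) and `q` (coded walks) corresponding under
  the coding, the twisted weights `x_c^{ℓ+1} e^{-iξ(θ_a + W)}` of the dirty arrivals at `v` in `p`
  (line vocabulary: `HexMidEdgeSAW`, `winding`) sum to those of the loop walks at `Φ v` in `q`;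
* `ss_dirtySum_eq` (registered): `Ā_ξ(z) - A_ξ(z) = viaSum - arrivalSum` is the twisted dirty sum;
* `ss_unstableNoDressing` (registered): `Ā_U(v) = A_U(v)` at a `1`-deep `v` (`ξ = -3/8`: the
  pairing factor is `1 + e^{iπ} = 0`) — the vertex relation of DCS in sector form.

Sources: H. Duminil-Copin, S. Smirnov, Ann. of Math. 175 (2012) (arXiv:1007.0575), §2, proof of
Lemma 1 ("walks visiting the three mid-edges can be grouped in pairs … we used the fact that `a`
is on the boundary and `Ω` is simply connected"); the line card `Lines/sector-slaving.md`
(`UnstableNoDressing` checked by exact enumeration, `|Ā_U - A_U| ≈ 1e-17·M` on discs `R ≤ 2`).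
-/

noncomputable section

open scoped BigOperators ComplexConjugate Classical
open Literature.Probability.LatticeModels Literature.Probability.RandomPlanarGeometry.SAW
open Summit.CriticalPhenomena.SAWScalingLimit.Theorems.DefectDecoherence.TipMartingale

namespace Summit.CriticalPhenomena.SAWScalingLimit.Theorems.DefectDecoherence.SectorSlaving

/-! ### Pairs in the coordinate model: left-first and right-first loop walks -/

section HVPairs

open HV

variable {V : Finset HV} {x : HV}

/-- **Left-first loop walks, evaluated on `lw`**: the loop walk `lw m₁ x m₂` (`x ∉ m₁`, `m₂ ≠ []`)
is LEFT-FIRST (its loop at `x` starts with a left turn, `turn = +1`) iff the turn from the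
entrance `lwS m₁` through `x` to the first loop vertex `m₂.head` is `+1`. [folklore] -/
theorem ss_hv_leftFirst_lw_iff {m₁ m₂ : List HV} (hx : x ∉ m₁) (hm₂ : m₂ ≠ []) :
    (∃ (n₁ n₂ : List HV) (h : HV), x ∉ n₁ ∧ lw m₁ x m₂ = lw n₁ x (h :: n₂) ∧
        turn (lwS n₁) x h = 1) ↔ turn (lwS m₁) x (m₂.head hm₂) = 1 := by
  constructor
  · rintro ⟨n₁, n₂, h, hx', he, ht⟩
    have he' : m₁ ++ x :: m₂ = n₁ ++ x :: (h :: n₂) :=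
      List.append_cancel_right (List.cons.inj he).2
    obtain ⟨rfl, rfl⟩ := split_unique hx hx' he'
    simpa using ht
  · intro ht
    obtain ⟨h, r, rfl⟩ := List.exists_cons_of_ne_nil hm₂
    exact ⟨m₁, r, h, hx, rfl, ht⟩

/-- **Anatomy of a loop walk and of its partner** (DCS's pair involution `loopRev`: the loop at
`x` traversed the other way), for a domain `V ∌ wOut` all of whose simple cycles are outside the
entrance: the partner is again a loop walk at `x`, of the same length, `loopRev` is an involution,
the windings differ by `8 · (π/3) · τ` with `τ = ±1` the entrance turn into the loop, and the
partner's entrance turn is `-τ` (Duminil-Copin–Smirnov 2012, proof of Lemma 1). [folklore] -/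
theorem ss_hv_loop_spec (hw : wOut ∉ V)
    (h₀ : ∀ c : List HV, (∀ y ∈ c, y ∈ V) → IsCyc c → wnd c (1, 0) = 0)
    {P : List HV} (hP : P ∈ clsLoop V x) :
    ∃ (m₁ m₂ : List HV) (hm₂ : m₂ ≠ []) (hm₂' : m₂.reverse ≠ []), x ∉ m₁ ∧ P = lw m₁ x m₂ ∧
      loopRev x P = lw m₁ x m₂.reverse ∧ loopRev x P ∈ clsLoop V x ∧
      loopRev x (loopRev x P) = P ∧ mwLen (loopRev x P) = mwLen P ∧
      pturn (loopRev x P) = pturn P + 8 * turn (lwS m₁) x (m₂.head hm₂) ∧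
      turn (lwS m₁) x (m₂.reverse.head hm₂') = -turn (lwS m₁) x (m₂.head hm₂) ∧
      (turn (lwS m₁) x (m₂.head hm₂) = 1 ∨ turn (lwS m₁) x (m₂.head hm₂) = -1) := by
  obtain ⟨m₁, m₂, hx, rfl⟩ := exists_eq_lw hP
  have hPw : IsMidWalk V (lw m₁ x m₂) := mem_midWalks_iff.1 (Finset.mem_filter.1 hP).1
  have h2 := lw_two_le hPw
  have hm₂ : m₂ ≠ [] := by rintro rfl; simp at h2
  have hm₂' : m₂.reverse ≠ [] := by simpa using hm₂
  obtain ⟨hvs, hvh, hvg, hsh, hhg, hsg, -⟩ := lw_nbrs_of_not_mem hw hPw hm₂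
  refine ⟨m₁, m₂, hm₂, hm₂', hx, rfl, loopRev_lw hx, ?_, ?_, ?_, ?_, ?_, ?_⟩
  · rw [loopRev_lw hx, clsLoop, Finset.mem_filter, mem_midWalks_iff, finalDart_lw _ _ hm₂',
      inner_lw]
    exact ⟨lw_rev_isMidWalk hPw, rfl, by simp⟩
  · rw [loopRev_lw hx, loopRev_lw hx, List.reverse_reverse]
  · rw [loopRev_lw hx, mwLen_lw, mwLen_lw, List.length_reverse]
  · rw [loopRev_lw hx]
    exact pturn_lw_rev_of_wnd hw h₀ hPw hm₂
  · rw [List.head_reverse]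
    exact turn_eq_neg_turn' hvs hvh hvg hsh hhg hsg
  · rcases adj_cases hvs hvh with e | e | e
    · exact absurd e.symm hsh
    · right; rw [e]; exact turn_ccw hvs
    · left; rw [e]; exact turn_cw hvs

/-- **The pairing identity in the coordinate model, every character `ξ`.**  Summing the twisted
weights `x_c^{ℓ+1} e^{-iξ(θ_a + (π/3)·pturn)}` over the loop walks at `x` gives
`(1 + e^{-iξ·8π/3})` times the sum over the LEFT-FIRST loop walks: `loopRev` is a bijection from
the left-first onto the right-first loop walks preserving the length and adding `8` to `pturn` (Duminil-Copin–Smirnov 2012, proof of Lemma 1). [folklore] -/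
theorem ss_hv_pairs (hw : wOut ∉ V)
    (h₀ : ∀ c : List HV, (∀ y ∈ c, y ∈ V) → IsCyc c → wnd c (1, 0) = 0) (ξ θa : ℝ) :
    ∑ P ∈ clsLoop V x, (xc : ℂ) ^ (mwLen P + 1) *
        Complex.exp (-Complex.I * ξ * ((θa + Real.pi / 3 * pturn P : ℝ) : ℂ)) =
      (1 + Complex.exp (-Complex.I * ξ * ((8 * Real.pi / 3 : ℝ) : ℂ))) *
        ∑ P ∈ (clsLoop V x).filter (fun P => ∃ (n₁ n₂ : List HV) (h : HV),
            x ∉ n₁ ∧ P = lw n₁ x (h :: n₂) ∧ turn (lwS n₁) x h = 1),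
          (xc : ℂ) ^ (mwLen P + 1) *
            Complex.exp (-Complex.I * ξ * ((θa + Real.pi / 3 * pturn P : ℝ) : ℂ)) := by
  set G : List HV → ℂ := fun P => (xc : ℂ) ^ (mwLen P + 1) *
    Complex.exp (-Complex.I * ξ * ((θa + Real.pi / 3 * pturn P : ℝ) : ℂ)) with hG
  set LQ : List HV → Prop := fun P => ∃ (n₁ n₂ : List HV) (h : HV),
    x ∉ n₁ ∧ P = lw n₁ x (h :: n₂) ∧ turn (lwS n₁) x h = 1 with hLQ
  -- the partner of a left-first walk is right-first and conversely; weights pick up the phase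
  have key : ∀ P ∈ clsLoop V x, loopRev x P ∈ clsLoop V x ∧ loopRev x (loopRev x P) = P ∧
      (LQ (loopRev x P) ↔ ¬ LQ P) ∧
      (LQ P → G (loopRev x P) = Complex.exp (-Complex.I * ξ * ((8 * Real.pi / 3 : ℝ) : ℂ)) * G P) := by
    intro P hP
    obtain ⟨m₁, m₂, hm₂, hm₂', hx, rfl, hrev, hmem, hinv, hlen, hpt, hτ', hτ⟩ :=
      ss_hv_loop_spec hw h₀ hP
    have e1 : LQ (lw m₁ x m₂) ↔ turn (lwS m₁) x (m₂.head hm₂) = 1 :=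
      ss_hv_leftFirst_lw_iff hx hm₂
    have e2 : LQ (loopRev x (lw m₁ x m₂)) ↔ turn (lwS m₁) x (m₂.reverse.head hm₂') = 1 := by
      rw [hrev]; exact ss_hv_leftFirst_lw_iff hx hm₂'
    refine ⟨hmem, hinv, ?_, fun hL => ?_⟩
    · rw [e1, e2, hτ']
      rcases hτ with h | h <;> rw [h] <;> norm_num
    · have ht : turn (lwS m₁) x (m₂.head hm₂) = 1 := e1.1 hL
      simp only [hG, hlen, hpt, ht]
      rw [mul_left_comm, ← Complex.exp_add]
      congr 2
      push_cast
      ring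
  rw [← Finset.sum_filter_add_sum_filter_not (clsLoop V x) LQ G]
  have hR : ∑ P ∈ (clsLoop V x).filter (fun P => ¬ LQ P), G P =
      ∑ P ∈ (clsLoop V x).filter LQ, G (loopRev x P) := by
    refine (Finset.sum_nbij' (loopRev x) (loopRev x) ?_ ?_ ?_ ?_ ?_).symm
    · intro P hP
      rw [Finset.mem_filter] at hP ⊢
      obtain ⟨h1, -, h3, -⟩ := key P hP.1
      exact ⟨h1, fun h => (h3.1 h) hP.2⟩
    · intro P hP
      rw [Finset.mem_filter] at hP ⊢
      obtain ⟨h1, -, h3, -⟩ := key P hP.1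
      exact ⟨h1, h3.2 hP.2⟩
    · intro P hP
      exact (key P (Finset.mem_filter.1 hP).1).2.1
    · intro P hP
      exact (key P (Finset.mem_filter.1 hP).1).2.1
    · intro P _
      rfl
  rw [hR, ← Finset.sum_add_distrib, Finset.mul_sum]
  refine Finset.sum_congr rfl fun P hP => ?_
  rw [Finset.mem_filter] at hP
  rw [(key P hP.1).2.2.2 hP.2]
  ring

end HVPairs

/-! ### Transport: dirty arrivals at `v` ↔ loop walks at `Φ v`, for every character -/

section Transport

open HV

variable {Λ : Finset HexVertex} {a : Sym2 HexVertex} {u w₁ v t : HexVertex}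
  {Φ : hexGraph ≃g hvGraph} {α β : ℂ}

/-- **The winding of a nontrivial walk is `(π/3) · pturn` of its code** (the chart is a
similarity, lattice turns are `±π/3`, half-edges at the ends do not turn; Duminil-Copin–Smirnov
2012, §2: the winding is the total rotation of the direction). [folklore] -/
-- adapted from `HexMidEdgeSAW.weight_eq_pwt` (HexParafermionProofs.lean), step (1)
theorem ss_winding_eq_pturn_code (γ : HexMidEdgeSAW Λ a s(v, t)) (ha : a = s(u, w₁))
    (hu : u ∉ Λ) (hΦu : Φ u = wOut) (hΦw : Φ w₁ = hvOrigin) (hvt : hexGraph.Adj v t)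
    (haff : ∀ f, emb (pos (Φ f)) = α * hexCenter f + β) (hα : α ≠ 0)
    (hne : γ.verts ≠ []) {e : HexVertex}
    (he : (γ.verts.getLast hne = v ∧ e = t) ∨ (γ.verts.getLast hne = t ∧ e = v)) :
    γ.winding = Real.pi / 3 * pturn (wOut :: (γ.verts.map Φ ++ [Φ e])) := by
  have hmw := γ.isMidWalk_code Φ ha hu hΦu hΦw hvt hne he
  set m := γ.verts.map Φ with hm
  have hmne : m ≠ [] := by simpa [hm] using hne
  have hcode : wOut :: (m ++ [Φ e]) = (u :: (γ.verts ++ [e])).map Φ := by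
    simp [hm, hΦu]
  have hc : ∀ f, hexCenter f = α⁻¹ * emb (pos (Φ f)) + -(β / α) := by
    intro f; rw [haff]; field_simp; ring
  rw [γ.winding_eq_winding_map ha hu hne he]
  have e1 : (u :: (γ.verts ++ [e])).map hexCenter =
      (((u :: (γ.verts ++ [e])).map Φ).map fun y => emb (pos y)).map
        fun z => α⁻¹ * z + -(β / α) := by
    simp only [List.map_map]
    exact List.map_congr_left fun f _ => hc f
  rw [e1, winding_map_affine (inv_ne_zero hα), ← hcode]
  refine winding_map_emb_pos _ hmw.1 ?_
  -- no backtracking in the code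
  have hQ : (wOut :: m).Nodup := by
    refine List.nodup_cons.2 ⟨fun h => hu ?_, γ.nodup.map Φ.injective⟩
    rw [hm, ← hΦu, List.mem_map] at h
    obtain ⟨y, hy, hyu⟩ := h
    exact Φ.injective hyu ▸ γ.subset y hy
  have hnb : ∀ (i : ℕ) (hi : i + 2 < ((wOut :: m) ++ [Φ e]).length),
      ((wOut :: m) ++ [Φ e])[i] ≠ ((wOut :: m) ++ [Φ e])[i + 2] := by
    intro i hi
    by_cases h2 : i + 2 < (wOut :: m).length
    · rw [List.getElem_append_left (by omega), List.getElem_append_left h2]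
      intro h
      have := (hQ.getElem_inj_iff).1 h
      omega
    · have hlen : i + 2 = (wOut :: m).length := by
        simp only [List.length_append, List.length_singleton] at hi
        omega
      rw [List.getElem_append_left (by omega), List.getElem_concat_length hlen,
        ← prevOf_eq_getElem_cons hmne (by omega) (by simp at hlen; omega)]
      exact (γ.map_ne_prevOf ha hu hΦu hne he).symm
  exact hnb

/-- **Transport of class-restricted twisted dirty sums.**  For a root `s(u,w₁)` (`u ∉ Λ ∋ w₁`)
mapped to the standard entrance by the chart `Φ`, a vertex `v` with all neighbours in `Λ`, and
classes `p` (vertex lists), `q` (coded walks) corresponding under the coding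
`γ ↦ wOut :: Φ(γ) ++ [Φ v]` on the dirty arrivals at `v`: the twisted weights
`x_c^{ℓ+1} e^{-iξ(θ_a + W)}` of the dirty arrivals at `v` in `p` sum to the twisted weights
`x_c^{ℓ+1} e^{-iξ(θ_a + (π/3)·pturn)}` of the loop walks at `Φ v` in `q` (every `ξ`). [folklore] -/
theorem ss_dirty_transport (hu : u ∉ Λ) (hw₁ : w₁ ∈ Λ) (huw : hexGraph.Adj u w₁)
    (hΦu : Φ u = wOut) (hΦw : Φ w₁ = hvOrigin)
    (haff : ∀ f, emb (pos (Φ f)) = α * hexCenter f + β) (hα : α ≠ 0)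
    (hΛ : ∀ s, hexGraph.Adj v s → s ∈ Λ)
    (p : List HexVertex → Prop) [DecidablePred p] (q : List HV → Prop) [DecidablePred q]
    (hpq : ∀ s, hexGraph.Adj v s → ∀ γ : HexMidEdgeSAW Λ s(u, w₁) s(s, v),
      γ.verts.getLast? = some s → v ∈ γ.verts →
        (p γ.verts ↔ q (wOut :: (γ.verts.map Φ ++ [Φ v])))) (ξ θa : ℝ) :
    (∑ s ∈ star Λ v, ∑ γ : HexMidEdgeSAW Λ s(u, w₁) s(s, v),
      if γ.verts.getLast? = some s ∧ v ∈ γ.verts ∧ p γ.verts then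
        (xc : ℂ) ^ (γ.length + 1) *
          Complex.exp (-Complex.I * ξ * ((θa + γ.winding : ℝ) : ℂ)) else 0) =
    ∑ P ∈ (clsLoop (Λ.map Φ.toEquiv.toEmbedding) (Φ v)).filter q,
      (xc : ℂ) ^ (mwLen P + 1) *
        Complex.exp (-Complex.I * ξ * ((θa + Real.pi / 3 * pturn P : ℝ) : ℂ)) := by
  set V := Λ.map Φ.toEquiv.toEmbedding with hV
  -- the left-hand side as a sum over a finite set of pairs (dart, walk)
  set T : Finset ((s : HexVertex) × HexMidEdgeSAW Λ s(u, w₁) s(s, v)) :=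
    (star Λ v).sigma fun s => Finset.univ.filter fun γ =>
      γ.verts.getLast? = some s ∧ v ∈ γ.verts ∧ p γ.verts with hT
  have hLHS : (∑ s ∈ star Λ v, ∑ γ : HexMidEdgeSAW Λ s(u, w₁) s(s, v),
      if γ.verts.getLast? = some s ∧ v ∈ γ.verts ∧ p γ.verts then
        (xc : ℂ) ^ (γ.length + 1) *
          Complex.exp (-Complex.I * ξ * ((θa + γ.winding : ℝ) : ℂ)) else 0) =
      ∑ x ∈ T, (xc : ℂ) ^ (x.2.length + 1) *
          Complex.exp (-Complex.I * ξ * ((θa + x.2.winding : ℝ) : ℂ)) := by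
    rw [hT, Finset.sum_sigma]
    refine Finset.sum_congr rfl fun s _ => ?_
    rw [Finset.sum_filter]
  rw [hLHS]
  -- facts about a dirty arrival and its code
  have hcode : ∀ (s : HexVertex), hexGraph.Adj v s → ∀ (γ : HexMidEdgeSAW Λ s(u, w₁) s(s, v)),
      γ.verts.getLast? = some s → v ∈ γ.verts →
        wOut :: (γ.verts.map Φ ++ [Φ v]) ∈ clsLoop V (Φ v) ∧
        γ.winding = Real.pi / 3 * pturn (wOut :: (γ.verts.map Φ ++ [Φ v])) := by
    intro s hvs γ hlast hvγ
    have hne : γ.verts ≠ [] := by rintro h; simp [h] at hlast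
    have hl : γ.verts.getLast hne = s :=
      Option.some_injective _ ((List.getLast?_eq_some_getLast hne).symm.trans hlast)
    have he : (γ.verts.getLast hne = s ∧ v = v) ∨ (γ.verts.getLast hne = v ∧ v = s) :=
      Or.inl ⟨hl, rfl⟩
    have hmw := γ.isMidWalk_code Φ rfl hu hΦu hΦw hvs.symm hne he
    obtain ⟨-, h2, hi⟩ := code_finalDart_fst_inner (Φ := Φ) γ hne v
    refine ⟨?_, ss_winding_eq_pturn_code γ rfl hu hΦu hΦw hvs.symm haff hα hne he⟩
    rw [clsLoop, Finset.mem_filter, mem_midWalks_iff, h2, hi]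
    exact ⟨hmw, rfl, List.mem_map_of_mem hvγ⟩
  refine Finset.sum_bij (fun x _ => wOut :: (x.2.verts.map Φ ++ [Φ v])) (fun x hx => ?_)
    (fun x hx y hy h => ?_) (fun P hP => ?_) (fun x hx => ?_)
  · -- the code is a loop walk at `Φ v` in the class `q`
    obtain ⟨hs, hx⟩ := Finset.mem_sigma.1 hx
    simp only [Finset.mem_filter, Finset.mem_univ, true_and] at hx
    obtain ⟨hlast, hvγ, hp⟩ := hx
    have hvs : hexGraph.Adj v x.1 := (tip_mem_star.1 hs).2
    exact Finset.mem_filter.2 ⟨(hcode x.1 hvs x.2 hlast hvγ).1,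
      (hpq x.1 hvs x.2 hlast hvγ).1 hp⟩
  · -- injectivity
    obtain ⟨-, hx'⟩ := Finset.mem_sigma.1 hx
    obtain ⟨-, hy'⟩ := Finset.mem_sigma.1 hy
    simp only [Finset.mem_filter, Finset.mem_univ, true_and] at hx' hy'
    have h' := congrArg List.dropLast (List.cons.inj h).2
    rw [List.dropLast_concat, List.dropLast_concat] at h'
    have hverts : x.2.verts = y.2.verts := List.map_injective_iff.2 Φ.injective h'
    refine tip_sigma_ext ?_ hverts
    have e := hx'.1
    rw [hverts, hy'.1] at e
    exact (Option.some_injective _ e).symm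
  · -- surjectivity: decode a loop walk at `Φ v`
    obtain ⟨hPl, hqP⟩ := Finset.mem_filter.1 hP
    have hadj : hvGraph.Adj (Φ v) (finalDart P).1 := adj_of_mem_clsLoop hPl
    rw [clsLoop, Finset.mem_filter, mem_midWalks_iff] at hPl
    obtain ⟨hPm, h2, hi⟩ := hPl
    obtain ⟨s, hΦs⟩ : ∃ s : HexVertex, Φ s = (finalDart P).1 :=
      ⟨Φ.symm (finalDart P).1, RelIso.apply_symm_apply Φ _⟩
    have hvs : hexGraph.Adj v s := by rw [← Φ.map_rel_iff, hΦs]; exact hadj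
    have hsΛ : s ∈ Λ := hΛ s hvs
    have hP0 : P ≠ [wOut, hvOrigin] := by rintro rfl; simp [HV.inner] at hi
    have hfd : finalDart P = (Φ s, Φ v) ∨ finalDart P = (Φ v, Φ s) :=
      Or.inl (Prod.ext hΦs.symm h2)
    obtain ⟨γ, hne, e, he, hPe⟩ := exists_code_eq rfl hu hw₁ huw hΦu hΦw hvs.symm hsΛ hPm hP0 hfd
    obtain ⟨h1, -, hi'⟩ := code_finalDart_fst_inner (Φ := Φ) γ hne e
    rw [hPe] at hΦs hi hqP
    have hl : γ.verts.getLast hne = s := Φ.injective (h1.symm.trans hΦs.symm)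
    have hev : e = v := by
      rcases he with ⟨-, h⟩ | ⟨h, -⟩
      · exact h
      · exact absurd (hl.symm.trans h) hvs.ne.symm
    have hlast : γ.verts.getLast? = some s := by rw [List.getLast?_eq_some_getLast hne, hl]
    have hvγ : v ∈ γ.verts := by
      rw [hi'] at hi
      exact (List.mem_map_of_injective Φ.injective).1 hi
    refine ⟨⟨s, γ⟩, Finset.mem_sigma.2 ⟨tip_mem_star.2 ⟨hsΛ, hvs⟩, ?_⟩, by rw [hPe, hev]⟩
    simp only [Finset.mem_filter, Finset.mem_univ, true_and]
    rw [hev] at hqP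
    exact ⟨hlast, hvγ, (hpq s hvs γ hlast hvγ).2 hqP⟩
  · -- the weights agree
    obtain ⟨hs, hx'⟩ := Finset.mem_sigma.1 hx
    simp only [Finset.mem_filter, Finset.mem_univ, true_and] at hx'
    have hvs : hexGraph.Adj v x.1 := (tip_mem_star.1 hs).2
    rw [(hcode x.1 hvs x.2 hx'.1 hx'.2.1).2, mwLen_cons_append, List.length_map]
    rfl

end Transport

/-! ### The dirty sum (registered helper of this file) -/

/-- **The loop-dressed part of the via-dart sum, termwise** (registered helper `ss_dirtySum_eq`):
`Ā_ξ(z) - A_ξ(z)` is the twisted sum over the DIRTY arrivals at `z` (last vertex the neighbour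
`s`, `z` visited earlier). [folklore] -/
theorem ss_dirtySum_eq : ∀ (Λ : Finset HexVertex) (a : Sym2 HexVertex) (θa ξ : ℝ) (z : HexVertex),
    viaSum Λ a θa ξ z - arrivalSum Λ a θa ξ z =
      ∑ s ∈ star Λ z, ∑ γ : HexMidEdgeSAW Λ a s(s, z),
        if γ.verts.getLast? = some s ∧ z ∈ γ.verts then
          (xc : ℂ) ^ (γ.length + 1) *
            Complex.exp (-Complex.I * (ξ : ℂ) * ((θa + γ.winding : ℝ) : ℂ))
        else 0 := by
  intro Λ a θa ξ z
  unfold viaSum arrivalSum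
  rw [← Finset.sum_sub_distrib]
  refine Finset.sum_congr rfl fun s _ => ?_
  rw [← Finset.sum_sub_distrib]
  refine Finset.sum_congr rfl fun γ _ => ?_
  by_cases hl : γ.verts.getLast? = some s <;> by_cases hz : z ∈ γ.verts <;> simp [hl, hz]


/-! ### No dressing in the unstable sector (registered helper of this file) -/

/-- `e^{-i(-3/8)(8π/3)} = e^{iπ} = -1`. [folklore] -/
theorem ss_phase_unstable :
    Complex.exp (-Complex.I * ((-3 / 8 : ℝ) : ℂ) * ((8 * Real.pi / 3 : ℝ) : ℂ)) = -1 := by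
  rw [show -Complex.I * ((-3 / 8 : ℝ) : ℂ) * ((8 * Real.pi / 3 : ℝ) : ℂ) = Real.pi * Complex.I by
    push_cast; ring]
  exact Complex.exp_pi_mul_I

open HV in
/-- **No dressing in the unstable sector** (registered helper `ss_unstableNoDressing`; the vertex
relation of Duminil-Copin–Smirnov for the loop class, in sector form): at a `1`-deep vertex `v` of
a simply connected `Λ` with adjacent boundary root, `Ā_U(v) = A_U(v)` — at `ξ = -3/8` the pairing
factor is `1 + e^{iπ} = 0` (Duminil-Copin–Smirnov 2012, Lemma 1, loop class). [folklore] -/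
theorem ss_unstableNoDressing : ∀ (Λ : Finset HexVertex), hexDomainSimplyConnected Λ →
    ∀ (u w : HexVertex), hexGraph.Adj u w → u ∉ Λ → w ∈ Λ →
      ∀ v : HexVertex, Deep Λ v 1 →
        viaSum Λ s(u, w) (rootAngle u w) (-3 / 8) v =
          arrivalSum Λ s(u, w) (rootAngle u w) (-3 / 8) v := by
  intro Λ hΛsc u w huw hu hw v hdeep
  have hΛ : ∀ t, hexGraph.Adj v t → t ∈ Λ := fun t ht =>
    hdeep t (dist_hexCenter_le_one_of_adj ht.symm)
  obtain ⟨Φ, α, β, hα, hΦu, hΦw, haff⟩ := exists_chart huw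
  have hwV : wOut ∉ Λ.map Φ.toEquiv.toEmbedding := by
    intro h
    obtain ⟨y, hy, hyu⟩ := Finset.mem_map.1 h
    exact hu (Φ.injective ((show Φ y = wOut from hyu).trans hΦu.symm) ▸ hy)
  have h₀ := fun c hc hcyc => wnd_eq_zero_of_simplyConnected (Φ := Φ) hΛsc hu hΦu c hc hcyc
  have h2 := ss_dirty_transport hu hw huw hΦu hΦw haff hα hΛ (fun _ => True) (fun _ => True)
    (fun _ _ _ _ _ => Iff.rfl) (-3 / 8) (rootAngle u w)
  rw [Finset.filter_true] at h2
  simp only [and_true] at h2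
  rw [← sub_eq_zero, ss_dirtySum_eq, h2, ss_hv_pairs hwV h₀, ss_phase_unstable, add_neg_cancel,
    zero_mul]

end Summit.CriticalPhenomena.SAWScalingLimit.Theorems.DefectDecoherence.SectorSlaving

end
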